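import Summits.QuantumFields.YangMills.Theorems.BalabanUVNodesN24LineTwoRung1AtThm1CCMWZDoorGOfChildrenBoxLetters
import Summits.QuantumFields.YangMills.Theorems.BalabanUVNodesK0PrintCubeOfStepTokensGridGuarded
import Summits.QuantumFields.YangMills.Theorems.BalabanUVNodesN11K1WitnessGaussPinHAtZ
import Summits.QuantumFields.YangMills.Theorems.BalabanUVNodesN11NodeFacesOfSupplyChainTokensAtZWitness

/-!
# NODE N24 (B2) — THE V21-G ROAD: K0⁷'s FACE OF RECORD SINCE 17:11Z (plan g87 `[YMPLAN-G87-K0V21G-REGISTERED 1d9e17422df218f7]`, director-ym g12 №226; grid guard `A‴(c, c₀, c₁)`), ROAD-FREE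
# CHILDREN FAMILIES, N11 IN ITS OWN CURRENCY, AT THE GAUSS-PIN CERTIFICATE `θᴳᶻ := gaussPinH (ofHistoryBlind (ofCured θ₁₅ᶜᶜᴹᵂᶻ(j; γ; Efl, logz)))`: LINE 2′'s RUNG 1ⱽᵂ, THE REGISTERED
# v10 STUB TYPE AND K1⁹ `StabilityBRunRowsAtRecordR13SepCoPHV` (stmt-QuantumFields-27364) BY NAME — p648169 with the K0 face moved V20-G ↦ V21-G the hour V21-G registered

TRACK A (YM-PLAN §2d, node N24 of 28 = binder B2), seat `pub-ymgap-dag-n24-c` (R134 s2; gen 13, CLAIM-60).  Key of record K1⁹ = stmt-QuantumFields-27364 (`--kind proof --supports 27364 --as helper`,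
Summits lane; count-neutral).  [V] = [Balaban1989LargeFieldII]; [III] = [Balaban1988Convergent]; [I] = [Balaban1987RG1]; [15] = [Balaban1985Variational]; [6] = [Balaban1985RegularSpaces].

WHY.  K0⁷'s by-name targets changed at 17:11Z: V20-G (`Prop8StepCoPGAt`, `AbsBetaBoxAtThm1WitnessCCMGenGAt`) RETIRED-OF-RECORD, V21-G's `stub_prop8StepCoPGridG13 : ∀ F, Prop8StepCoPGridGAt F` and
`stub_absBetaBoxAtThm1WitnessCCMGenGridG13 : ∀ F, AbsBetaBoxAtThm1WitnessCCMGenGridGAt F` REGISTERED (stub-1 guard re-typed to the grid guard `A‴(c, c₀, c₁) := fun ν M g K k _ => c ≤ ν.M₁ ∧ k + c₀ ≤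
F.m + K ∧ F.L^{c₁} ∣ M ∧ ∀ i, 1 ≤ i ≤ k → dCubeSide … ∣ sitesPerDir 0`; the 3ᴬ′ text gains the binder `c₁` and rider `c₁ ≤ j`).  Stub 1 is ANTITONE in the guard (k0-s1-w3
`prop8StepCoPG3_of_prop8StepCoPG`: G ⟹ G‴, never conversely), so NO V20-G-keyed K1-face closer (p643157, p648169) can be fed from the registered V21-G stub 1.  THIS FILE re-keys p648169
at the V21-G texts, spelled VERBATIM (= k0-s1-w3 p646365's `h1G3` ∕ `h3A'G3` binders, which the skeleton copied; a tree-definition file for the two names does not exist yet — `exact stub_… F`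
feeds the spelled text by δ-reduction once it does).  Everything downstream of the door tuple is p648169's: the road-free children families (the guard is read by no child), N11's `h11N`
binder and dag-n11-w1's Gauss-pin rows ∕ windowed operand-rows road, engine p639124, W-END road p638487.  The GRID-GUARD z-DOOR ROWS are composed INLINE by k0-s1-w3's own recipe
(`K0NamedZWitnessOfStepTokensGuarded` §1–§2, now at `A‴`): k0-s1-w3 p645438's `bgSepCoPAt_theta13OfThm1CCMW_gridGuard_of_thm1RegSepCoP7MG_of_thm1GaugeG_of_hcomp_allTorus` transported to
the z-witness definitionally (letter-blind objects), K0a's `provisos₁₃SepCoP_liveRepin₁₃_of_bgSepCoP` at Z2's `theta13OfNumericsZ`, `.ofCured.ofHistoryBlind`, dag-n11-w1's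
`antecedent_gaussPinH` — no k0-currency theorem is DECLARED here (their named Grid z-rows file, when a k0 seat types it, replaces four proof lines).

WHAT THIS FILE PROVES (3 theorems, 0 `def`, 0 `sorry`; standard axioms).  §1 `N24_nodesAtSomeRecord13PWSVW_byName_gaussPinZ_doorGridG_of_stub1GridG_stub3A'GridG_of_children_n11OperandRows_boxLetters`
(per `F`, letters `(Efl, logz)`) · §2 ★★★ `N24_stub_nodes13PWSVW_text_gaussPinZ_doorGridG_of_openStubsGridG_of_children_n11OperandRows_boxLetters` — THE REGISTERED v10 STUB TYPE
`∀ F, Inhabited13 F → NodesAtSomeRecord13PWSVW F` from V21-G's two REGISTERED K0 stub texts + the road-free families + `h11N` · §3 ★★★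
`N24_stabilityBRunRowsAtRecordR13SepCoPHV_byName_gaussPinZ_doorGridG_of_openStubsGridG_of_children_n11OperandRows_boxLetters_of_stub2VW_stub3VW` — K1⁹ BY NAME (W-END road p638487).

WHICH CHILD BLOCKS AT `θᴳᶻ` ON THE V21-G ROAD (= §3's hypotheses): K0⁷ V21-G stubs 1-G‴ ∧ 3ᴬ′-G‴ (REGISTERED; N07 road R0′ ∕ NODE O + N26); N05 `h05`; N06 `h06`; N07 `h07`; N08 `h08`; N09 `h09` + `h09T`;
N10 `h10`; N11 `h11N` ([III] §3's supplier with `SupplierObligations` = Thm 2 proper, XL, + operand rows on windowed runs); N12 `h12`; N13 `h13` (slot letter at `θᴳᶻ`'s datum); β-side `h₂`, `h₃`.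

HONEST FRAMING.  Composition BY NAME; NO estimate; nothing of Bałaban's asserted; every family, the two REGISTERED K0 stub texts, [III] §3's supplier obligations and def-T's operand rows
DISPLAYED as hypotheses (CONDITIONAL, audit `proof.conditional`); letters `Efl`, `logz` FREE; NOT a claim that `θᴳᶻ` is K1⁹'s witness; NO V21-G ∕ v10 stub proved, used as proved or closed;
N07 ∕ N11 ∕ N13 NOT discharged; N24 COMPOSITE — no count moved (typed 28∕28 · discharged 5∕27 · A 5∕28); K0⁷ «V21-G 0∕2 (+2′)» ∕ K1⁹ stmt-QuantumFields-27364 (DECIDING; v10 0∕6) ∕ K3⁸ OPEN;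
one finite 𝕋⁴ programme at fixed ε, Bałaban AS PRINTED; R4 = the conditional finite-𝕋⁴ rung `BalabanLadder.UV` only — NOT continuum ∕ ℝ⁴ ∕ OS ∕ mass gap ∕ Clay: the Yang–Mills mass gap
is NOT proved by any of this.  No `sorry`, `def`, `instance`, `notation`; standard axioms.
-/

noncomputable section

open scoped Matrix.Norms.L2Operator BigOperators

namespace Summit.QuantumFields.YangMills.BalabanUVNodes.N24LineTwoRung1AtGaussPinZCertificateDoorGridGOfChildrenBoxLetters

open Literature.MathematicalPhysics.QuantumFieldTheory.Balaban1983to89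
open Literature.MathematicalPhysics.QuantumFieldTheory.Balaban1983to89.Node00
open DagBinding T4Continuum T4DatumAssembly FlowStepRuns AveragingRT
open FlowStep (BetaLowerH BetaUpperH RGEqH prefixOf)
open Summit.QuantumFields.YangMills.BalabanUVNodes.N07Thm1Top7FromProp8 (variationalThm1RegSepCoP7MG_of_prop8TopStepG)
open Summit.QuantumFields.YangMills.Theorems.K0PrintCubeOfStepTokensGridGuarded (gauge9SupplierG3_of_prop6MemberP)
open Summit.QuantumFields.YangMills.Theorems.K0Stub1GridNumericsGuardWitness (bgSepCoPAt_theta13OfThm1CCMW_gridGuard_of_thm1RegSepCoP7MG_of_thm1GaugeG_of_hcomp_allTorus)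
open Summit.QuantumFields.YangMills.Theorems.BalabanUVNodesN11GaussianCertificateDefs (gaussPinH antecedent_gaussPinH)
open Summit.QuantumFields.YangMills.Theorems.BalabanUVNodesN11Sect3SupplyChainDefs (Sect3Supplier)
open Summit.QuantumFields.YangMills.Theorems.BalabanUVNodesN11Sect3SupplyChainObligationsDefs (SupplierObligations OperandRowsAlongChain)
open Summit.QuantumFields.YangMills.Theorems.BalabanUVNodesN11K1WitnessGaussPinHAtZ (N13_laws₁₃CoPH_all_gaussPinH_ofHistoryBlind_theta13OfThm1CCMWZ)
open Summit.QuantumFields.YangMills.Theorems.BalabanUVNodesN11NodeFacesOfSupplyChainTokensAtZWitness (h11Family_gaussPinH_ofHistoryBlind_theta13OfThm1CCMWZ_of_operandRows_windowed)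
open Summit.QuantumFields.YangMills.BalabanUVNodes.N24K1ConsequentOfStubsV19AndChildren (windowLetters_of_absBetaBoxH)
open Summit.QuantumFields.YangMills.Theorems.K1V6Defs (Inhabited13)
open Summit.QuantumFields.YangMills.Theorems.K1V10Defs (NodesAtSomeRecord13PWSVW RunRowsAtSomeRecord13PWSVW RunRowsContAtSomeRecord13PWSVW)
open Summit.QuantumFields.YangMills.BalabanUVNodes.N24LineTwoRung1AtAbstractWitnessOfChildrenSlotLetter (N24_nodesAtSomeRecord13PWSVW_byName_atWitness)
open Summit.QuantumFields.YangMills.BalabanUVNodes.K1R9BodyAtRevisedRecordWorldOfNodesWRunLetters (stabilityBRunRowsAtRecordR13SepCoPHV_of_stubTextsVW)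

variable {F : T4Family}

/-! ## §1. `N = 2`, per `F`, letters `(Efl, logz)`: rung 1ⱽᵂ BY NAME at the Gauss-pin certificate of the cured z-witness from V21-G's REGISTERED stub 1-G‴ ∧ 3ᴬ′-G‴ TEXTS (grid guard `A‴`), road-free children families, N11's supplier binder -/

/-- **★★ LINE 2′'s RUNG 1ⱽᵂ BY NAME AT `F` FROM V21-G's REGISTERED STUB TEXTS (`stub_prop8StepCoPGridG13`'s and `stub_absBetaBoxAtThm1WitnessCCMGenGridG13`'s, skeleton 1d9e17422df218f7, spelled VERBATIM
= k0-s1-w3 p646365's binders `h1G3` ∕ `h3A'G3` with the grid guard `A‴(c, c₀, c₁)`), ROAD-FREE CHILDREN FAMILIES AND N11's SUPPLIER BINDER AT `θᴳᶻ := gaussPinH (ofHistoryBlind (ofCured θ₁₅ᶜᶜᴹᵂᶻ))`** —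
p648169 §1 with the K0 face moved V20-G ↦ V21-G: the door tuple `(j, c′, c₀, c₁, B₉, a₁′)` by k0-s1-w3's `gauge9SupplierG3_of_prop6MemberP` (stub 2′ landed inside), `h15` at `A‴(c′, c₀, c₁)` by
dag-n07-e's guard-generic `variationalThm1RegSepCoP7MG_of_prop8TopStepG` + antitonicity (`c ≤ c′`), the box from `h3A'G3 j c′ c₀ c₁ …` (riders `c₀ ≤ j + 1`, `c₁ ≤ j` supplied), window letters by
`windowLetters_of_absBetaBoxH`, `hcomp ∧ hcompRev` by `hcompBoth_theta13OfThm1CCMW_of_betaBoxSignFree`; THE GRID-GUARD z-DOOR ROWS composed inline by k0-s1-w3's recipe (`K0NamedZWitnessOfStepTokensGuarded`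
§1–§2 at `A‴`): row P11 at the z-witness = k0-s1-w3's `bgSepCoPAt_theta13OfThm1CCMW_gridGuard_…` by definitional transport (letter-blind objects, `rfl`), K0a's θ-generic
`provisos₁₃SepCoP_liveRepin₁₃_of_bgSepCoP` at Z2's `theta13OfNumericsZ`, node00-def-R's `.ofCured` ∕ def-T's `.ofHistoryBlind`, then dag-n11-w1's `antecedent_gaussPinH` (`ZhUnity` UNCONDITIONAL);
law row `N13_laws₁₃CoPH_all_gaussPinH_…`; N11 = `h11N` through `h11Family_gaussPinH_ofHistoryBlind_theta13OfThm1CCMWZ_of_operandRows_windowed`; engine p639124.  The children families are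
p648169's VERBATIM (road-free: the guard is not read by any child).  CONDITIONAL display; no stub closed; nothing of Bałaban asserted. [cite: Balaban1989LargeFieldII, Thm 1 p.355, (0.1) pp.355–356, (0.15) p.360; Balaban1988Convergent, (0.2) p.244, Theorem p.245, (1.15) p.249, (2.1) p.254, (2.5)–(2.8) pp.255–256, (2.18) p.257, (2.21) p.258, (2.28) p.259, Thm 1 p.262, Cor. 3 (2.50) p.264, (3.16)–(3.25) pp.268–270, §3 p.279; Balaban1987RG1, (0.1) p.251, (0.15) p.254, Thm 1 p.255, Thm 3 p.264, (0.17)–(0.20) pp.255–256; Balaban1985Variational, (6)–(7) p.278, Thm 1 (8)–(9) p.279, (144)–(152) pp.300–301, Prop. 8 p.304; Balaban1985RegularSpaces, (1.3)–(1.9) p.77, Prop. 6 p.99, Prop. 7 (1.145) p.100, Thm 8 (1.146) p.101; Balaban1985UV3, Thm 1 p.257; Balaban1989LargeFieldI, (0.2)–(0.6) p.176, Prop. 1 p.194 (bookkeeping)] -/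
theorem N24_nodesAtSomeRecord13PWSVW_byName_gaussPinZ_doorGridG_of_stub1GridG_stub3A'GridG_of_children_n11OperandRows_boxLetters (Efl logz : B12.RunParams → ℕ → ℝ)
    (h1G3 : ∃ (c c₀ c₁ : ℕ) (B₃ a₀ a₁ : ℝ), 2 * (F.L : ℝ) ^ 2 ≤ B₃ ∧ 0 < a₀ ∧ 0 < a₁ ∧
      Prop8RegSepTopStepG F 2 (fun ν K Ω => suppDomOfRecord F ν K Ω) (fun ν M g K k _s => c ≤ ν.M₁ ∧ k + c₀ ≤ F.m + K ∧ F.L ^ c₁ ∣ M ∧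
      ∀ i, 1 ≤ i → i ≤ k → dCubeSide (F.P K).L M (RkOfRecord (F.P K).L ν.r (g i)) i ∣ (F.P K).sitesPerDir 0) B₃ a₀ a₁)
    (h3A'G3 : ∀ (j c c₀ c₁ : ℕ) (B₃ B₃' a₀ a₁ : ℝ), c ≤ F.L ^ j → c₀ ≤ j + 1 → c₁ ≤ j → 2 * (F.L : ℝ) ^ 2 ≤ B₃ → 0 < B₃' → 0 < a₀ → 0 < a₁ →
      VariationalThm1RegSepCoP7MG F 2 (fun ν M g K k _s => c ≤ ν.M₁ ∧ k + c₀ ≤ F.m + K ∧ F.L ^ c₁ ∣ M ∧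
      ∀ i, 1 ≤ i → i ≤ k → dCubeSide (F.P K).L M (RkOfRecord (F.P K).L ν.r (g i)) i ∣ (F.P K).sitesPerDir 0) B₃ a₀ a₁ →
      Gauge9RegSepTopStepG F 2 (fun ν K Ω => suppDomOfRecord F ν K Ω) (F.L ^ j) (fun ν M g K k _s => c ≤ ν.M₁ ∧ k + c₀ ≤ F.m + K ∧ F.L ^ c₁ ∣ M ∧
      ∀ i, 1 ≤ i → i ≤ k → dCubeSide (F.P K).L M (RkOfRecord (F.P K).L ν.r (g i)) i ∣ (F.P K).sitesPerDir 0) B₃ B₃' a₀ a₁ →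
      ∃ γ₀ ε₀ ε₂₉ β' : ℝ, 0 < γ₀ ∧ 0 < ε₀ ∧ 0 < ε₂₉ ∧
        BetaLowerH (-β') γ₀ (betaOfRecord₁₃ F 2 (theta13OfThm1CCM F 2 j ε₀ ε₂₉ B₃ B₃' a₀ a₁)) ∧
        BetaUpperH β' γ₀ (betaOfRecord₁₃ F 2 (theta13OfThm1CCM F 2 j ε₀ ε₂₉ B₃ B₃' a₀ a₁)))
    (h05F : ∀ {j : ℕ} {γ ε₀ ε₂₉ B₃ B₃' a₀ a₁ : ℝ} (hγ₀ : 0 < γ) (hγh : γ ≤ 1 / 2) (hε : 0 < ε₀) (hε' : 0 < ε₂₉) (hB : 0 ≤ B₃) (hB' : 0 ≤ B₃') (ha₀ : 0 < a₀) (ha₁ : 0 < a₁) {bl β' : ℝ} (hbox : BetaLowerH bl γ (betaOfRecord₁₃ F 2 (theta13OfThm1CCMWZ F 2 j γ ε₀ ε₂₉ B₃ B₃' a₀ a₁ Efl logz))) (hbox' : BetaUpperH β' γ (betaOfRecord₁₃ F 2 (theta13OfThm1CCMWZ F 2 j γ ε₀ ε₂₉ B₃ B₃' a₀ a₁ Efl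 logz))) (hl : -bl * γ ^ 2 ≤ 3) (hβ' : β' * γ ^ 2 ≤ 3 / 4),
      ∃ lam8 : ResidB8 (theta13OfThm1CCMWZ F 2 j γ ε₀ ε₂₉ B₃ B₃' a₀ a₁ Efl logz).toStage3Params, B8LeafOfRecordSubBP (theta13OfThm1CCMWZ F 2 j γ ε₀ ε₂₉ B₃ B₃' a₀ a₁ Efl logz).toStage3Params lam8)
    (h06F : ∀ {j : ℕ} {γ ε₀ ε₂₉ B₃ B₃' a₀ a₁ : ℝ} (hγ₀ : 0 < γ) (hγh : γ ≤ 1 / 2) (hε : 0 < ε₀) (hε' : 0 < ε₂₉) (hB : 0 ≤ B₃) (hB' : 0 ≤ B₃') (ha₀ : 0 < a₀) (ha₁ : 0 < a₁) {bl β' : ℝ} (hbox : BetaLowerH bl γ (betaOfRecord₁₃ F 2 (theta13OfThm1CCMWZ F 2 j γ ε₀ ε₂₉ B₃ B₃' a₀ a₁ Efl logz))) (hbox' : BetaUpperH β' γ (betaOfRecord₁₃ F 2 (theta13OfThm1CCMWZ F 2 j γ ε₀ ε₂₉ B₃ B₃' a₀ a₁ Efl logz))) (hl : -bl * γ ^ 2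 ≤ 3) (hβ' : β' * γ ^ 2 ≤ 3 / 4),
      ∃ (Mstar : ℕ) (ops : OpsY 2 (theta13OfThm1CCMWZ F 2 j γ ε₀ ε₂₉ B₃ B₃' a₀ a₁ Efl logz).toStage3Params Mstar), B9LeafX (Y9OfRecord 2 (theta13OfThm1CCMWZ F 2 j γ ε₀ ε₂₉ B₃ B₃' a₀ a₁ Efl logz).toStage3Params Mstar ops))
    (h07 : ∃ ζ : ResidZ F 2, B11Leaf (Z11OfRecord F 2 ζ))
    (h08 : PrintedUV3V 2 F.L)
    (h09F : ∀ {j : ℕ} {γ ε₀ ε₂₉ B₃ B₃' a₀ a₁ : ℝ} (hγ₀ : 0 < γ) (hγh : γ ≤ 1 / 2) (hε : 0 < ε₀) (hε' : 0 < ε₂₉) (hB : 0 ≤ B₃) (hB' : 0 ≤ B₃') (ha₀ : 0 < a₀) (ha₁ : 0 < a₁) {bl β' : ℝ} (hbox : BetaLowerH bl γ (betaOfRecord₁₃ F 2 (theta13OfThm1CCMWZ F 2 j γ ε₀ ε₂₉ B₃ B₃' a₀ a₁ Efl logz))) (hbox' : BetaUpperH β' γ (betaOfRecord₁₃ F 2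 (theta13OfThm1CCMWZ F 2 j γ ε₀ ε₂₉ B₃ B₃' a₀ a₁ Efl logz))) (hl : -bl * γ ^ 2 ≤ 3) (hβ' : β' * γ ^ 2 ≤ 3 / 4),
      ∃ lam12 : ResidB12 F 2 (theta13OfThm1CCMWZ F 2 j γ ε₀ ε₂₉ B₃ B₃' a₀ a₁ Efl logz).τ9.M,
      ∀ P : B12.RunParams, B12Sec2to5.Lemma4Printed (F12OfRecord₁₂ F 2 (theta13OfThm1CCMWZ F 2 j γ ε₀ ε₂₉ B₃ B₃' a₀ a₁ Efl logz).toStage12Params lam12 P) (lam12 P).consts)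
    (h09TF : ∀ {j : ℕ} {γ ε₀ ε₂₉ B₃ B₃' a₀ a₁ : ℝ} (hγ₀ : 0 < γ) (hγh : γ ≤ 1 / 2) (hε : 0 < ε₀) (hε' : 0 < ε₂₉) (hB : 0 ≤ B₃) (hB' : 0 ≤ B₃') (ha₀ : 0 < a₀) (ha₁ : 0 < a₁) {bl β' : ℝ} (hbox : BetaLowerH bl γ (betaOfRecord₁₃ F 2 (theta13OfThm1CCMWZ F 2 j γ ε₀ ε₂₉ B₃ B₃' a₀ a₁ Efl logz))) (hbox' : BetaUpperH β' γ (betaOfRecord₁₃ F 2 (theta13OfThm1CCMWZ F 2 j γ ε₀ ε₂₉ B₃ B₃' a₀ a₁ Efl logz))) (hl : -bl * γ ^ 2 ≤ 3) (hβ' : β' * γ ^ 2 ≤ 3 / 4)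
      (hP : (gaussPinH (Stage13HParams.ofHistoryBlind F 2 (Stage13RParams.ofCured F 2 (theta13OfThm1CCMWZ F 2 j γ ε₀ ε₂₉ B₃ B₃' a₀ a₁ Efl logz)))).Provisos₁₃SepCoPH F 2),
      ∃ γ₉ : ℝ, 0 < γ₉ ∧ ∀ w : WorldP, w.C = (datumOfRecord₁₃SepCoPH F 2 (gaussPinH (Stage13HParams.ofHistoryBlind F 2 (Stage13RParams.ofCured F 2 (theta13OfThm1CCMWZ F 2 j γ ε₀ ε₂₉ B₃ B₃' a₀ a₁ Efl logz)))) hP).C →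
      w.γ ≤ γ₉ → ∀ P : B12.RunParams, (leavesP w P).smallCouplings → (leavesP w P).smallFieldInductive)
    (h10F : ∀ {j : ℕ} {γ ε₀ ε₂₉ B₃ B₃' a₀ a₁ : ℝ} (hγ₀ : 0 < γ) (hγh : γ ≤ 1 / 2) (hε : 0 < ε₀) (hε' : 0 < ε₂₉) (hB : 0 ≤ B₃) (hB' : 0 ≤ B₃') (ha₀ : 0 < a₀) (ha₁ : 0 < a₁) {bl β' : ℝ} (hbox : BetaLowerH bl γ (betaOfRecord₁₃ F 2 (theta13OfThm1CCMWZ F 2 j γ ε₀ ε₂₉ B₃ B₃' a₀ a₁ Efl logz))) (hbox' : BetaUpperH β' γ (betaOfRecord₁₃ F 2 (theta13OfThm1CCMWZ F 2 j γ ε₀ ε₂₉ B₃ B₃' a₀ a₁ Efl logz))) (hl : -bl * γ ^ 2 ≤ 3) (hβ' : β' * γ ^ 2 ≤ 3 / 4),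
      ∃ lam13 : B12.RunParams → ResidB13 (theta13OfThm1CCMWZ F 2 j γ ε₀ ε₂₉ B₃ B₃' a₀ a₁ Efl logz).toStage3Params,
      ∀ P : B12.RunParams, B13LeafOfRecord (theta13OfThm1CCMWZ F 2 j γ ε₀ ε₂₉ B₃ B₃' a₀ a₁ Efl logz).toStage3Params (lam13 P))
    (h11N : ∀ {j : ℕ} {γ ε₀ ε₂₉ B₃ B₃' a₀ a₁ : ℝ} (hγ₀ : 0 < γ) (hγh : γ ≤ 1 / 2) (hε : 0 < ε₀) (hε' : 0 < ε₂₉) (hB : 0 ≤ B₃) (hB' : 0 ≤ B₃') (ha₀ : 0 < a₀) (ha₁ : 0 < a₁) {bl β' : ℝ} (hbox : BetaLowerH bl γ (betaOfRecord₁₃ F 2 (theta13OfThm1CCMWZ F 2 j γ ε₀ ε₂₉ B₃ B₃' a₀ a₁ Efl logz))) (hbox' : BetaUpperH β' γ (betaOfRecord₁₃ F 2 (theta13OfThm1CCMWZ F 2 j γ ε₀ ε₂₉ B₃ B₃' a₀ a₁ Efl logz))) (hl : -bl * γ ^ 2 ≤ 3) (hβ' : β' * γ ^ 2 ≤ 3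 / 4),
      ∃ σ : (P : B12.RunParams) → Sect3Supplier (gaussPinH (Stage13HParams.ofHistoryBlind F 2 (Stage13RParams.ofCured F 2 (theta13OfThm1CCMWZ F 2 j γ ε₀ ε₂₉ B₃ B₃' a₀ a₁ Efl logz)))) P,
        (∀ P : B12.RunParams, Step.InInterval γ P.K (gOfRecord₁₃ F 2 (theta13OfThm1CCMWZ F 2 j γ ε₀ ε₂₉ B₃ B₃' a₀ a₁ Efl logz) P) → SupplierObligations (gaussPinH (Stage13HParams.ofHistoryBlind F 2 (Stage13RParams.ofCured F 2 (theta13OfThm1CCMWZ F 2 j γ ε₀ ε₂₉ B₃ B₃' a₀ a₁ Efl logz)))) P (σ P)) ∧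
        (∀ P : B12.RunParams, Step.InInterval γ P.K (gOfRecord₁₃ F 2 (theta13OfThm1CCMWZ F 2 j γ ε₀ ε₂₉ B₃ B₃' a₀ a₁ Efl logz) P) → OperandRowsAlongChain (gaussPinH (Stage13HParams.ofHistoryBlind F 2 (Stage13RParams.ofCured F 2 (theta13OfThm1CCMWZ F 2 j γ ε₀ ε₂₉ B₃ B₃' a₀ a₁ Efl logz)))) P (σ P)))
    (h12F : ∀ {j : ℕ} {γ ε₀ ε₂₉ B₃ B₃' a₀ a₁ : ℝ} (hγ₀ : 0 < γ) (hγh : γ ≤ 1 / 2) (hε : 0 < ε₀) (hε' : 0 < ε₂₉) (hB : 0 ≤ B₃) (hB' : 0 ≤ B₃') (ha₀ : 0 < a₀) (ha₁ : 0 < a₁) {bl β' : ℝ} (hbox : BetaLowerH bl γ (betaOfRecord₁₃ F 2 (theta13OfThm1CCMWZ F 2 j γ ε₀ ε₂₉ B₃ B₃' a₀ a₁ Efl logz))) (hbox' : BetaUpperH β' γ (betaOfRecord₁₃ F 2 (theta13OfThm1CCMWZ F 2 j γ ε₀ ε₂₉ B₃ B₃' a₀ a₁ Efl logz))) (hl :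 -bl * γ ^ 2 ≤ 3) (hβ' : β' * γ ^ 2 ≤ 3 / 4),
      ∃ lamW : ResidW F 2, (∀ P : B12.RunParams, B15Leaf (WOfRecord₁₃ F 2 (theta13OfThm1CCMWZ F 2 j γ ε₀ ε₂₉ B₃ B₃' a₀ a₁ Efl logz) lamW P)) ∧
      ∀ P : B12.RunParams, 1 ≤ P.K → lamW.kSel P < P.K)
    (h13F : ∀ {j : ℕ} {γ ε₀ ε₂₉ B₃ B₃' a₀ a₁ : ℝ} (hγ₀ : 0 < γ) (hγh : γ ≤ 1 / 2) (hε : 0 < ε₀) (hε' : 0 < ε₂₉) (hB : 0 ≤ B₃) (hB' : 0 ≤ B₃') (ha₀ : 0 < a₀) (ha₁ : 0 < a₁) {bl β' : ℝ} (hbox : BetaLowerH bl γ (betaOfRecord₁₃ F 2 (theta13OfThm1CCMWZ F 2 j γ ε₀ ε₂₉ B₃ B₃' a₀ a₁ Efl logz))) (hbox' : BetaUpperH β' γ (betaOfRecord₁₃ F 2 (theta13OfThm1CCMWZ F 2 j γ ε₀ ε₂₉ B₃ B₃' a₀ a₁ Efl logz))) (hl : -bl * γ ^ 2 ≤ 3)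 (hβ' : β' * γ ^ 2 ≤ 3 / 4)
      (hP : (gaussPinH (Stage13HParams.ofHistoryBlind F 2 (Stage13RParams.ofCured F 2 (theta13OfThm1CCMWZ F 2 j γ ε₀ ε₂₉ B₃ B₃' a₀ a₁ Efl logz)))).Provisos₁₃SepCoPH F 2),
      ∃ γ₁₃ : ℝ, 0 < γ₁₃ ∧ ∃ em ep : ℝ → ℝ, ∃ v : Revision₁₃ F 2 (gaussPinH (Stage13HParams.ofHistoryBlind F 2 (Stage13RParams.ofCured F 2 (theta13OfThm1CCMWZ F 2 j γ ε₀ ε₂₉ B₃ B₃' a₀ a₁ Efl logz)))) hP,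
      ∀ P : B12.RunParams, (genFlow (betaOfRecord₁₃ F 2 (theta13OfThm1CCMWZ F 2 j γ ε₀ ε₂₉ B₃ B₃' a₀ a₁ Efl logz)) P.g0).InInterval γ₁₃ P.K → ∀ k, k ≤ P.K → SLaw₁₃CoPH F 2 (gaussPinH (Stage13HParams.ofHistoryBlind F 2 (Stage13RParams.ofCured F 2 (theta13OfThm1CCMWZ F 2 j γ ε₀ ε₂₉ B₃ B₃' a₀ a₁ Efl logz)))) P k →
      ∀ U : GaugeField (F.P P.K) k (SU 2),
        chiβOfRecord₁₃ F 2 (theta13OfThm1CCMWZ F 2 j γ ε₀ ε₂₉ B₃ B₃' a₀ a₁ Efl logz) P.K (gOfRecord₁₃ F 2 (theta13OfThm1CCMWZ F 2 j γ ε₀ ε₂₉ B₃ B₃' a₀ a₁ Efl logz) P) k U *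
              Real.exp (-(1 / (gOfRecord₁₃ F 2 (theta13OfThm1CCMWZ F 2 j γ ε₀ ε₂₉ B₃ B₃' a₀ a₁ Efl logz) P k) ^ 2 * wilsonBGOfRecord F 2 (theta13OfThm1CCMWZ F 2 j γ ε₀ ε₂₉ B₃ B₃' a₀ a₁ Efl logz).εbg P k U)
                - em (gOfRecord₁₃ F 2 (theta13OfThm1CCMWZ F 2 j γ ε₀ ε₂₉ B₃ B₃' a₀ a₁ Efl logz) P k) * (Fintype.card (Site (F.P P.K) k) : ℝ)) ≤ v.ρ P k U ∧
        v.ρ P k U ≤ Real.exp (ep (gOfRecord₁₃ F 2 (theta13OfThm1CCMWZ F 2 j γ ε₀ ε₂₉ B₃ B₃' a₀ a₁ Efl logz) P k) * (Fintype.card (Site (F.P P.K) k) : ℝ))) :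
    NodesAtSomeRecord13PWSVW F := by
  obtain ⟨c, c₀, c₁, B₃, a₀, a₁, hB₃, ha₀, ha₁, h8⟩ := h1G3
  have hL0 : (0 : ℝ) < (F.L : ℝ) := by exact_mod_cast lt_trans Nat.zero_lt_one F.hL.2
  have hBpos : (0 : ℝ) < B₃ := lt_of_lt_of_le (mul_pos two_pos (pow_pos hL0 2)) hB₃
  obtain ⟨j, c', B₉, a₁', hcc', hc', hc₀, hc₁, hB9, ha₁', ha₁'le, h9⟩ :=
    gauge9SupplierG3_of_prop6MemberP F (Summit.QuantumFields.YangMills.Theorems.K0Stub2PrimeHolds.prop6MemberB8AtP_holds F) c c₀ c₁ B₃ a₀ a₁ hB₃ ha₀ ha₁ h8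
  have h15 : VariationalThm1RegSepCoP7MG F 2 (fun ν M g K k _s => c' ≤ ν.M₁ ∧ k + c₀ ≤ F.m + K ∧ F.L ^ c₁ ∣ M ∧
      ∀ i, 1 ≤ i → i ≤ k → dCubeSide (F.P K).L M (RkOfRecord (F.P K).L ν.r (g i)) i ∣ (F.P K).sitesPerDir 0) B₃ a₀ a₁' :=
    (variationalThm1RegSepCoP7MG_of_prop8TopStepG hBpos (h8.of_le le_rfl ha₁'le)).of_imp fun _ _ _ _ _ _ h => ⟨hcc'.trans h.1, h.2⟩
  obtain ⟨γ₀, ε₀, ε₂₉, β', hγ0, hε, hε', hlow, hup⟩ := h3A'G3 j c' c₀ c₁ B₃ B₉ a₀ a₁' hc' hc₀ hc₁ hB₃ hB9 ha₀ ha₁' h15 h9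
  obtain ⟨γ, hγpos, hγh, hl, hu, hlow', hup'⟩ := windowLetters_of_absBetaBoxH hγ0 hlow hup
  have hloW := betaLowerH_theta13OfThm1CCMW_of_half (F := F) (N := 2) (j := j) (ε₀ := ε₀) (ε₂₉ := ε₂₉) (B₃ := B₃) (B₃' := B₉) (a₀ := a₀) (a₁ := a₁') hγh hlow'
  have hupW := betaUpperH_theta13OfThm1CCMW_of_half (F := F) (N := 2) (j := j) (ε₀ := ε₀) (ε₂₉ := ε₂₉) (B₃ := B₃) (B₃' := B₉) (a₀ := a₀) (a₁ := a₁') hγh hup'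
  have hloZ : BetaLowerH _ γ (betaOfRecord₁₃ F 2 (theta13OfThm1CCMWZ F 2 j γ ε₀ ε₂₉ B₃ B₉ a₀ a₁' Efl logz)) := hloW
  have hupZ : BetaUpperH _ γ (betaOfRecord₁₃ F 2 (theta13OfThm1CCMWZ F 2 j γ ε₀ ε₂₉ B₃ B₉ a₀ a₁' Efl logz)) := hupW
  have H := hcompBoth_theta13OfThm1CCMW_of_betaBoxSignFree (F := F) (N := 2) (j := j) (ε₀ := ε₀) (ε₂₉ := ε₂₉) hγh hBpos.le hB9.le ha₀.le ha₁'.le hloW hupW hl hu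
  -- the GRID-GUARD z-door rows (k0-s1-w3's recipe of `K0NamedZWitnessOfStepTokensGuarded` §1–§2 at `A‴`, composed inline): row P11 at the z-witness by definitional transport of the
  -- θ₁₅ᶜᶜᴹᵂ grid-guard theorem (every object it reads is letter-blind, `rfl`), then K0a's θ-generic live-re-pin provisos, the cured ∕ history-blind lifts, and dag-n11-w1's certificate
  have hPZ : (theta13OfThm1CCMWZ F 2 j γ ε₀ ε₂₉ B₃ B₉ a₀ a₁' Efl logz).Provisos₁₃SepCoP F 2 :=
    (theta13OfNumericsZ F 2 (stage12NumericsOfThm1CCMW F.L j γ ε₀ B₃ B₉ a₀ a₁') ε₂₉ _ _ _ Efl logz).provisos₁₃SepCoP_liveRepin₁₃_of_bgSepCoP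
      (hasResidualsOfRecord_theta13OfNumericsZ F 2 _ ε₂₉ Efl logz) ⟨j, rfl⟩ (dvd_refl _)
      (bgSepCoPAt_theta13OfThm1CCMW_gridGuard_of_thm1RegSepCoP7MG_of_thm1GaugeG_of_hcomp_allTorus hγpos hγh hε hε' hBpos.le hB9.le ha₀ ha₁' hc' hc₀ hc₁ h15
        (variationalThm1GaugeRegSepCoP7MG_of_gauge9TopStepG h9) H.1 H.2)
  have hG := antecedent_gaussPinH hPZ.ofCured.ofHistoryBlind (slotsNondegenerate₁₃_theta13OfThm1CCMWZ F 2 j γ ε₀ ε₂₉ B₃ B₉ a₀ a₁' Efl logz)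
    (admissible_theta13OfThm1CCMWZ_of_le_half F 2 Efl logz hγpos hγh hε hε' hBpos.le hB9.le ha₀ ha₁')
  obtain ⟨σ, hσ, hops⟩ := h11N hγpos hγh hε hε' hBpos.le hB9.le ha₀ ha₁' hloZ hupZ hl hu
  exact N24_nodesAtSomeRecord13PWSVW_byName_atWitness (gaussPinH (Stage13HParams.ofHistoryBlind F 2 (Stage13RParams.ofCured F 2 (theta13OfThm1CCMWZ F 2 j γ ε₀ ε₂₉ B₃ B₉ a₀ a₁' Efl logz)))) hG.1 hG.2.2 hG.2.1
    (N13_laws₁₃CoPH_all_gaussPinH_ofHistoryBlind_theta13OfThm1CCMWZ _ hγpos hγh hε hε' hBpos.le hB9.le ha₀ ha₁')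
    (h05F hγpos hγh hε hε' hBpos.le hB9.le ha₀ ha₁' hloZ hupZ hl hu) (h06F hγpos hγh hε hε' hBpos.le hB9.le ha₀ ha₁' hloZ hupZ hl hu) h07 h08
    (h09F hγpos hγh hε hε' hBpos.le hB9.le ha₀ ha₁' hloZ hupZ hl hu) (h09TF hγpos hγh hε hε' hBpos.le hB9.le ha₀ ha₁' hloZ hupZ hl hu hG.1)
    (h10F hγpos hγh hε hε' hBpos.le hB9.le ha₀ ha₁' hloZ hupZ hl hu) (h11Family_gaussPinH_ofHistoryBlind_theta13OfThm1CCMWZ_of_operandRows_windowed _ hγpos hγh hε hε' hBpos.le hB9.le ha₀ ha₁' hG.1 hγpos σ hσ hops)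
    (h12F hγpos hγh hε hε' hBpos.le hB9.le ha₀ ha₁' hloZ hupZ hl hu) (h13F hγpos hγh hε hε' hBpos.le hB9.le ha₀ ha₁' hloZ hupZ hl hu hG.1)

/-! ## §2. ★★★ THE REGISTERED STUB TYPE from V21-G's two REGISTERED stub texts BY NAME (spelled verbatim), the road-free children families and N11's supplier binder at the Gauss-pin certificate -/

/-- **★★★ v10's `stub_nodes13PWSVW` TEXT FROM V21-G's TWO REGISTERED STUB TEXTS (`∀ F, Prop8StepCoPGridGAt F`, `∀ F, AbsBetaBoxAtThm1WitnessCCMGenGridGAt F` — K0⁷'s by-name targets since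
17:11Z, spelled VERBATIM so that `fun F => stub_… F` feeds them by `exact` once proved), THE ROAD-FREE CHILDREN FAMILIES AND N11's SUPPLIER BINDER `h11N` AT `θᴳᶻ(…; Efl F, logz F)`** — so by-name
proofs of the two registered K0⁷ stubs + the children families + [III] §3's supplier with obligations and operand rows on windowed runs + the two β-side VW texts close K1⁹ (§3).
CONDITIONAL (every family displayed); NO stub proved; no count moved. [cite: Balaban1989LargeFieldII, Thm 1 p.355, (0.1) pp.355–356, (0.15) p.360; Balaban1988Convergent, (0.2) p.244, Theorem p.245, (1.15) p.249, (2.1) p.254, (2.5)–(2.8) pp.255–256, (2.18) p.257, (2.21) p.258, (2.28) p.259, Thm 1 p.262, Cor. 3 (2.50) p.264, (3.16)–(3.25) pp.268–270, §3 p.279; Balaban1987RG1, (0.1) p.251, (0.15) p.254, Thm 1 p.255, Thm 3 p.264, (0.17)–(0.20) pp.255–256; Balaban1985Variational, (6)–(7) p.278, Thm 1 (8)–(9) p.279, (144)–(152) pp.300–301, Prop. 8 p.304; Balaban1985RegularSpaces, (1.3)–(1.9) p.77, Prop. 6 p.99, Prop. 7 (1.145) p.100, Thm 8 (1.146) p.101;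 Balaban1985UV3, Thm 1 p.257; Balaban1989LargeFieldI, (0.2)–(0.6) p.176, Prop. 1 p.194 (bookkeeping)] -/
theorem N24_stub_nodes13PWSVW_text_gaussPinZ_doorGridG_of_openStubsGridG_of_children_n11OperandRows_boxLetters (Efl logz : (F : T4Family) → B12.RunParams → ℕ → ℝ)
    (h1G3 : ∀ F : T4Family, ∃ (c c₀ c₁ : ℕ) (B₃ a₀ a₁ : ℝ), 2 * (F.L : ℝ) ^ 2 ≤ B₃ ∧ 0 < a₀ ∧ 0 < a₁ ∧
      Prop8RegSepTopStepG F 2 (fun ν K Ω => suppDomOfRecord F ν K Ω) (fun ν M g K k _s => c ≤ ν.M₁ ∧ k + c₀ ≤ F.m + K ∧ F.L ^ c₁ ∣ M ∧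
      ∀ i, 1 ≤ i → i ≤ k → dCubeSide (F.P K).L M (RkOfRecord (F.P K).L ν.r (g i)) i ∣ (F.P K).sitesPerDir 0) B₃ a₀ a₁)
    (h3A'G3 : ∀ F : T4Family, ∀ (j c c₀ c₁ : ℕ) (B₃ B₃' a₀ a₁ : ℝ), c ≤ F.L ^ j → c₀ ≤ j + 1 → c₁ ≤ j → 2 * (F.L : ℝ) ^ 2 ≤ B₃ → 0 < B₃' → 0 < a₀ → 0 < a₁ →
      VariationalThm1RegSepCoP7MG F 2 (fun ν M g K k _s => c ≤ ν.M₁ ∧ k + c₀ ≤ F.m + K ∧ F.L ^ c₁ ∣ M ∧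
      ∀ i, 1 ≤ i → i ≤ k → dCubeSide (F.P K).L M (RkOfRecord (F.P K).L ν.r (g i)) i ∣ (F.P K).sitesPerDir 0) B₃ a₀ a₁ →
      Gauge9RegSepTopStepG F 2 (fun ν K Ω => suppDomOfRecord F ν K Ω) (F.L ^ j) (fun ν M g K k _s => c ≤ ν.M₁ ∧ k + c₀ ≤ F.m + K ∧ F.L ^ c₁ ∣ M ∧
      ∀ i, 1 ≤ i → i ≤ k → dCubeSide (F.P K).L M (RkOfRecord (F.P K).L ν.r (g i)) i ∣ (F.P K).sitesPerDir 0) B₃ B₃' a₀ a₁ →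
      ∃ γ₀ ε₀ ε₂₉ β' : ℝ, 0 < γ₀ ∧ 0 < ε₀ ∧ 0 < ε₂₉ ∧
        BetaLowerH (-β') γ₀ (betaOfRecord₁₃ F 2 (theta13OfThm1CCM F 2 j ε₀ ε₂₉ B₃ B₃' a₀ a₁)) ∧
        BetaUpperH β' γ₀ (betaOfRecord₁₃ F 2 (theta13OfThm1CCM F 2 j ε₀ ε₂₉ B₃ B₃' a₀ a₁)))
    (h05 : ∀ (F : T4Family) {j : ℕ} {γ ε₀ ε₂₉ B₃ B₃' a₀ a₁ : ℝ} (hγ₀ : 0 < γ) (hγh : γ ≤ 1 / 2) (hε : 0 < ε₀) (hε' : 0 < ε₂₉) (hB : 0 ≤ B₃) (hB' : 0 ≤ B₃') (ha₀ : 0 < a₀) (ha₁ : 0 < a₁) {bl β' : ℝ} (hbox : BetaLowerH bl γ (betaOfRecord₁₃ F 2 (theta13OfThm1CCMWZ F 2 j γ ε₀ ε₂₉ B₃ B₃' a₀ a₁ (Efl F) (logz F)))) (hbox' : BetaUpperH β' γ (betaOfRecord₁₃ F 2 (theta13OfThm1CCMWZ F 2 j γ ε₀ ε₂₉ B₃ B₃'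 a₀ a₁ (Efl F) (logz F)))) (hl : -bl * γ ^ 2 ≤ 3) (hβ' : β' * γ ^ 2 ≤ 3 / 4),
      ∃ lam8 : ResidB8 (theta13OfThm1CCMWZ F 2 j γ ε₀ ε₂₉ B₃ B₃' a₀ a₁ (Efl F) (logz F)).toStage3Params, B8LeafOfRecordSubBP (theta13OfThm1CCMWZ F 2 j γ ε₀ ε₂₉ B₃ B₃' a₀ a₁ (Efl F) (logz F)).toStage3Params lam8)
    (h06 : ∀ (F : T4Family) {j : ℕ} {γ ε₀ ε₂₉ B₃ B₃' a₀ a₁ : ℝ} (hγ₀ : 0 < γ) (hγh : γ ≤ 1 / 2) (hε : 0 < ε₀) (hε' : 0 < ε₂₉) (hB : 0 ≤ B₃) (hB' : 0 ≤ B₃') (ha₀ : 0 < a₀) (ha₁ : 0 < a₁) {bl β' : ℝ} (hbox : BetaLowerH bl γ (betaOfRecord₁₃ F 2 (theta13OfThm1CCMWZ F 2 j γ ε₀ ε₂₉ B₃ B₃' a₀ a₁ (Efl F) (logz F)))) (hbox' : BetaUpperH β' γ (betaOfRecord₁₃ F 2 (theta13OfThm1CCMWZ F 2 j γ ε₀ ε₂₉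 B₃ B₃' a₀ a₁ (Efl F) (logz F)))) (hl : -bl * γ ^ 2 ≤ 3) (hβ' : β' * γ ^ 2 ≤ 3 / 4),
      ∃ (Mstar : ℕ) (ops : OpsY 2 (theta13OfThm1CCMWZ F 2 j γ ε₀ ε₂₉ B₃ B₃' a₀ a₁ (Efl F) (logz F)).toStage3Params Mstar), B9LeafX (Y9OfRecord 2 (theta13OfThm1CCMWZ F 2 j γ ε₀ ε₂₉ B₃ B₃' a₀ a₁ (Efl F) (logz F)).toStage3Params Mstar ops))
    (h07 : ∀ F : T4Family, ∃ ζ : ResidZ F 2, B11Leaf (Z11OfRecord F 2 ζ))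
    (h08 : ∀ F : T4Family, PrintedUV3V 2 F.L)
    (h09 : ∀ (F : T4Family) {j : ℕ} {γ ε₀ ε₂₉ B₃ B₃' a₀ a₁ : ℝ} (hγ₀ : 0 < γ) (hγh : γ ≤ 1 / 2) (hε : 0 < ε₀) (hε' : 0 < ε₂₉) (hB : 0 ≤ B₃) (hB' : 0 ≤ B₃') (ha₀ : 0 < a₀) (ha₁ : 0 < a₁) {bl β' : ℝ} (hbox : BetaLowerH bl γ (betaOfRecord₁₃ F 2 (theta13OfThm1CCMWZ F 2 j γ ε₀ ε₂₉ B₃ B₃' a₀ a₁ (Efl F) (logz F)))) (hbox' : BetaUpperH β' γ (betaOfRecord₁₃ F 2 (theta13OfThm1CCMWZ F 2 j γ ε₀ ε₂₉ B₃ B₃' a₀ a₁ (Efl F) (logz F)))) (hl : -bl * γ ^ 2 ≤ 3) (hβ' : β' * γ ^ 2 ≤ 3 / 4),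
      ∃ lam12 : ResidB12 F 2 (theta13OfThm1CCMWZ F 2 j γ ε₀ ε₂₉ B₃ B₃' a₀ a₁ (Efl F) (logz F)).τ9.M,
      ∀ P : B12.RunParams, B12Sec2to5.Lemma4Printed (F12OfRecord₁₂ F 2 (theta13OfThm1CCMWZ F 2 j γ ε₀ ε₂₉ B₃ B₃' a₀ a₁ (Efl F) (logz F)).toStage12Params lam12 P) (lam12 P).consts)
    (h09T : ∀ (F : T4Family) {j : ℕ} {γ ε₀ ε₂₉ B₃ B₃' a₀ a₁ : ℝ} (hγ₀ : 0 < γ) (hγh : γ ≤ 1 / 2) (hε : 0 < ε₀) (hε' : 0 < ε₂₉) (hB : 0 ≤ B₃) (hB' : 0 ≤ B₃') (ha₀ : 0 < a₀) (ha₁ : 0 < a₁) {bl β' : ℝ} (hbox : BetaLowerH bl γ (betaOfRecord₁₃ F 2 (theta13OfThm1CCMWZ F 2 j γ ε₀ ε₂₉ B₃ B₃' a₀ a₁ (Efl F) (logz F)))) (hbox' : BetaUpperH β' γ (betaOfRecord₁₃ F 2 (theta13OfThm1CCMWZ F 2 j γ ε₀ ε₂₉ B₃ B₃' a₀ a₁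 (Efl F) (logz F)))) (hl : -bl * γ ^ 2 ≤ 3) (hβ' : β' * γ ^ 2 ≤ 3 / 4)
      (hP : (gaussPinH (Stage13HParams.ofHistoryBlind F 2 (Stage13RParams.ofCured F 2 (theta13OfThm1CCMWZ F 2 j γ ε₀ ε₂₉ B₃ B₃' a₀ a₁ (Efl F) (logz F))))).Provisos₁₃SepCoPH F 2),
      ∃ γ₉ : ℝ, 0 < γ₉ ∧ ∀ w : WorldP, w.C = (datumOfRecord₁₃SepCoPH F 2 (gaussPinH (Stage13HParams.ofHistoryBlind F 2 (Stage13RParams.ofCured F 2 (theta13OfThm1CCMWZ F 2 j γ ε₀ ε₂₉ B₃ B₃' a₀ a₁ (Efl F) (logz F))))) hP).C →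
      w.γ ≤ γ₉ → ∀ P : B12.RunParams, (leavesP w P).smallCouplings → (leavesP w P).smallFieldInductive)
    (h10 : ∀ (F : T4Family) {j : ℕ} {γ ε₀ ε₂₉ B₃ B₃' a₀ a₁ : ℝ} (hγ₀ : 0 < γ) (hγh : γ ≤ 1 / 2) (hε : 0 < ε₀) (hε' : 0 < ε₂₉) (hB : 0 ≤ B₃) (hB' : 0 ≤ B₃') (ha₀ : 0 < a₀) (ha₁ : 0 < a₁) {bl β' : ℝ} (hbox : BetaLowerH bl γ (betaOfRecord₁₃ F 2 (theta13OfThm1CCMWZ F 2 j γ ε₀ ε₂₉ B₃ B₃' a₀ a₁ (Efl F) (logz F)))) (hbox' : BetaUpperH β' γ (betaOfRecord₁₃ F 2 (theta13OfThm1CCMWZ F 2 j γ ε₀ ε₂₉ B₃ B₃' a₀ a₁ (Efl F) (logz F)))) (hl : -bl * γ ^ 2 ≤ 3) (hβ' : β' * γ ^ 2 ≤ 3 / 4),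
      ∃ lam13 : B12.RunParams → ResidB13 (theta13OfThm1CCMWZ F 2 j γ ε₀ ε₂₉ B₃ B₃' a₀ a₁ (Efl F) (logz F)).toStage3Params,
      ∀ P : B12.RunParams, B13LeafOfRecord (theta13OfThm1CCMWZ F 2 j γ ε₀ ε₂₉ B₃ B₃' a₀ a₁ (Efl F) (logz F)).toStage3Params (lam13 P))
    (h11N : ∀ (F : T4Family) {j : ℕ} {γ ε₀ ε₂₉ B₃ B₃' a₀ a₁ : ℝ} (hγ₀ : 0 < γ) (hγh : γ ≤ 1 / 2) (hε : 0 < ε₀) (hε' : 0 < ε₂₉) (hB : 0 ≤ B₃) (hB' : 0 ≤ B₃') (ha₀ : 0 < a₀) (ha₁ : 0 < a₁) {bl β' : ℝ} (hbox : BetaLowerH bl γ (betaOfRecord₁₃ F 2 (theta13OfThm1CCMWZ F 2 j γ ε₀ ε₂₉ B₃ B₃' a₀ a₁ (Efl F) (logz F)))) (hbox' : BetaUpperH β' γ (betaOfRecord₁₃ F 2 (theta13OfThm1CCMWZ F 2 j γ ε₀ ε₂₉ B₃ B₃' a₀ a₁ (Efl F) (logz F)))) (hl : -bl * γ ^ 2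 ≤ 3) (hβ' : β' * γ ^ 2 ≤ 3 / 4),
      ∃ σ : (P : B12.RunParams) → Sect3Supplier (gaussPinH (Stage13HParams.ofHistoryBlind F 2 (Stage13RParams.ofCured F 2 (theta13OfThm1CCMWZ F 2 j γ ε₀ ε₂₉ B₃ B₃' a₀ a₁ (Efl F) (logz F))))) P,
        (∀ P : B12.RunParams, Step.InInterval γ P.K (gOfRecord₁₃ F 2 (theta13OfThm1CCMWZ F 2 j γ ε₀ ε₂₉ B₃ B₃' a₀ a₁ (Efl F) (logz F)) P) → SupplierObligations (gaussPinH (Stage13HParams.ofHistoryBlind F 2 (Stage13RParams.ofCured F 2 (theta13OfThm1CCMWZ F 2 j γ ε₀ ε₂₉ B₃ B₃' a₀ a₁ (Efl F) (logz F))))) P (σ P)) ∧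
        (∀ P : B12.RunParams, Step.InInterval γ P.K (gOfRecord₁₃ F 2 (theta13OfThm1CCMWZ F 2 j γ ε₀ ε₂₉ B₃ B₃' a₀ a₁ (Efl F) (logz F)) P) → OperandRowsAlongChain (gaussPinH (Stage13HParams.ofHistoryBlind F 2 (Stage13RParams.ofCured F 2 (theta13OfThm1CCMWZ F 2 j γ ε₀ ε₂₉ B₃ B₃' a₀ a₁ (Efl F) (logz F))))) P (σ P)))
    (h12 : ∀ (F : T4Family) {j : ℕ} {γ ε₀ ε₂₉ B₃ B₃' a₀ a₁ : ℝ} (hγ₀ : 0 < γ) (hγh : γ ≤ 1 / 2) (hε : 0 < ε₀) (hε' : 0 < ε₂₉) (hB : 0 ≤ B₃) (hB' : 0 ≤ B₃') (ha₀ : 0 < a₀) (ha₁ : 0 < a₁) {bl β' : ℝ} (hbox : BetaLowerH bl γ (betaOfRecord₁₃ F 2 (theta13OfThm1CCMWZ F 2 j γ ε₀ ε₂₉ B₃ B₃' a₀ a₁ (Efl F) (logz F)))) (hbox' : BetaUpperH β' γ (betaOfRecord₁₃ F 2 (theta13OfThm1CCMWZ F 2 j γ ε₀ ε₂₉ B₃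 B₃' a₀ a₁ (Efl F) (logz F)))) (hl : -bl * γ ^ 2 ≤ 3) (hβ' : β' * γ ^ 2 ≤ 3 / 4),
      ∃ lamW : ResidW F 2, (∀ P : B12.RunParams, B15Leaf (WOfRecord₁₃ F 2 (theta13OfThm1CCMWZ F 2 j γ ε₀ ε₂₉ B₃ B₃' a₀ a₁ (Efl F) (logz F)) lamW P)) ∧
      ∀ P : B12.RunParams, 1 ≤ P.K → lamW.kSel P < P.K)
    (h13 : ∀ (F : T4Family) {j : ℕ} {γ ε₀ ε₂₉ B₃ B₃' a₀ a₁ : ℝ} (hγ₀ : 0 < γ) (hγh : γ ≤ 1 / 2) (hε : 0 < ε₀) (hε' : 0 < ε₂₉) (hB : 0 ≤ B₃) (hB' : 0 ≤ B₃') (ha₀ : 0 < a₀) (ha₁ : 0 < a₁) {bl β' : ℝ} (hbox : BetaLowerH bl γ (betaOfRecord₁₃ F 2 (theta13OfThm1CCMWZ F 2 j γ ε₀ ε₂₉ B₃ B₃' a₀ a₁ (Efl F) (logz F)))) (hbox' : BetaUpperH β' γ (betaOfRecord₁₃ F 2 (theta13OfThm1CCMWZ F 2 j γ ε₀ ε₂₉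 B₃ B₃' a₀ a₁ (Efl F) (logz F)))) (hl : -bl * γ ^ 2 ≤ 3) (hβ' : β' * γ ^ 2 ≤ 3 / 4)
      (hP : (gaussPinH (Stage13HParams.ofHistoryBlind F 2 (Stage13RParams.ofCured F 2 (theta13OfThm1CCMWZ F 2 j γ ε₀ ε₂₉ B₃ B₃' a₀ a₁ (Efl F) (logz F))))).Provisos₁₃SepCoPH F 2),
      ∃ γ₁₃ : ℝ, 0 < γ₁₃ ∧ ∃ em ep : ℝ → ℝ, ∃ v : Revision₁₃ F 2 (gaussPinH (Stage13HParams.ofHistoryBlind F 2 (Stage13RParams.ofCured F 2 (theta13OfThm1CCMWZ F 2 j γ ε₀ ε₂₉ B₃ B₃' a₀ a₁ (Efl F) (logz F))))) hP,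
      ∀ P : B12.RunParams, (genFlow (betaOfRecord₁₃ F 2 (theta13OfThm1CCMWZ F 2 j γ ε₀ ε₂₉ B₃ B₃' a₀ a₁ (Efl F) (logz F))) P.g0).InInterval γ₁₃ P.K → ∀ k, k ≤ P.K → SLaw₁₃CoPH F 2 (gaussPinH (Stage13HParams.ofHistoryBlind F 2 (Stage13RParams.ofCured F 2 (theta13OfThm1CCMWZ F 2 j γ ε₀ ε₂₉ B₃ B₃' a₀ a₁ (Efl F) (logz F))))) P k →
      ∀ U : GaugeField (F.P P.K) k (SU 2),
        chiβOfRecord₁₃ F 2 (theta13OfThm1CCMWZ F 2 j γ ε₀ ε₂₉ B₃ B₃' a₀ a₁ (Efl F) (logz F)) P.K (gOfRecord₁₃ F 2 (theta13OfThm1CCMWZ F 2 j γ ε₀ ε₂₉ B₃ B₃' a₀ a₁ (Efl F) (logz F)) P) k U *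
              Real.exp (-(1 / (gOfRecord₁₃ F 2 (theta13OfThm1CCMWZ F 2 j γ ε₀ ε₂₉ B₃ B₃' a₀ a₁ (Efl F) (logz F)) P k) ^ 2 * wilsonBGOfRecord F 2 (theta13OfThm1CCMWZ F 2 j γ ε₀ ε₂₉ B₃ B₃' a₀ a₁ (Efl F) (logz F)).εbg P k U)
                - em (gOfRecord₁₃ F 2 (theta13OfThm1CCMWZ F 2 j γ ε₀ ε₂₉ B₃ B₃' a₀ a₁ (Efl F) (logz F)) P k) * (Fintype.card (Site (F.P P.K) k) : ℝ)) ≤ v.ρ P k U ∧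
        v.ρ P k U ≤ Real.exp (ep (gOfRecord₁₃ F 2 (theta13OfThm1CCMWZ F 2 j γ ε₀ ε₂₉ B₃ B₃' a₀ a₁ (Efl F) (logz F)) P k) * (Fintype.card (Site (F.P P.K) k) : ℝ))) :
    ∀ F : T4Family, Inhabited13 F → NodesAtSomeRecord13PWSVW F :=
  fun F _ => N24_nodesAtSomeRecord13PWSVW_byName_gaussPinZ_doorGridG_of_stub1GridG_stub3A'GridG_of_children_n11OperandRows_boxLetters (Efl F) (logz F) (h1G3 F) (h3A'G3 F)
    (h05 F) (h06 F) (h07 F) (h08 F) (h09 F) (h09T F) (h10 F) (h11N F) (h12 F) (h13 F)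

/-! ## §3. ★★★ K1⁹ BY NAME at the Gauss-pin certificate on the V21-G road: §2 + the two registered β-side LINE-2′ stub texts, through the W-END road -/

/-- **★★★ THE DECIDING CRUX `StabilityBRunRowsAtRecordR13SepCoPHV` (K1⁹, stmt-QuantumFields-27364) BY NAME ON THE V21-G ROAD AT THE GAUSS-PIN CERTIFICATE**: §2's hypotheses (V21-G's two
REGISTERED K0 stub texts, the road-free children families at `θᴳᶻ`, N11's supplier binder) + the two registered β-side LINE-2′ stub TEXTS (`h₂`, `h₃` over `K1V10Defs`) ⊢ the route decl,
through the W-END road p638487.  The K1-face closer in K0's currency OF RECORD (V21-G, 17:11Z) at the ONE H-extension of the z-witness where the N11 lanes can discharge N11's binder.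
CONDITIONAL on every displayed family; K0⁷ ∕ K1⁹ OPEN; no count moved.
[cite: Balaban1989LargeFieldII, Thm 1 p.355 + (0.1) pp.355–356, (0.15) p.360; Balaban1987RG1, (0.15) p.254, Thm 3 p.264, (1.22) p.264, (5.10) p.293, §1 pp.263–264; Balaban1988Convergent, Theorem p.245, (1.15) p.249, Cor. 3 (2.50) p.264, (3.16)–(3.25) pp.268–270, §3 p.279; Balaban1985Variational, Prop. 8 p.304; Balaban1988RG2Cluster, (2.41) p.21 (bookkeeping)] -/
theorem N24_stabilityBRunRowsAtRecordR13SepCoPHV_byName_gaussPinZ_doorGridG_of_openStubsGridG_of_children_n11OperandRows_boxLetters_of_stub2VW_stub3VW (Efl logz : (F : T4Family) → B12.RunParams → ℕ → ℝ)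
    (h1G3 : ∀ F : T4Family, ∃ (c c₀ c₁ : ℕ) (B₃ a₀ a₁ : ℝ), 2 * (F.L : ℝ) ^ 2 ≤ B₃ ∧ 0 < a₀ ∧ 0 < a₁ ∧
      Prop8RegSepTopStepG F 2 (fun ν K Ω => suppDomOfRecord F ν K Ω) (fun ν M g K k _s => c ≤ ν.M₁ ∧ k + c₀ ≤ F.m + K ∧ F.L ^ c₁ ∣ M ∧
      ∀ i, 1 ≤ i → i ≤ k → dCubeSide (F.P K).L M (RkOfRecord (F.P K).L ν.r (g i)) i ∣ (F.P K).sitesPerDir 0) B₃ a₀ a₁)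
    (h3A'G3 : ∀ F : T4Family, ∀ (j c c₀ c₁ : ℕ) (B₃ B₃' a₀ a₁ : ℝ), c ≤ F.L ^ j → c₀ ≤ j + 1 → c₁ ≤ j → 2 * (F.L : ℝ) ^ 2 ≤ B₃ → 0 < B₃' → 0 < a₀ → 0 < a₁ →
      VariationalThm1RegSepCoP7MG F 2 (fun ν M g K k _s => c ≤ ν.M₁ ∧ k + c₀ ≤ F.m + K ∧ F.L ^ c₁ ∣ M ∧
      ∀ i, 1 ≤ i → i ≤ k → dCubeSide (F.P K).L M (RkOfRecord (F.P K).L ν.r (g i)) i ∣ (F.P K).sitesPerDir 0) B₃ a₀ a₁ →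
      Gauge9RegSepTopStepG F 2 (fun ν K Ω => suppDomOfRecord F ν K Ω) (F.L ^ j) (fun ν M g K k _s => c ≤ ν.M₁ ∧ k + c₀ ≤ F.m + K ∧ F.L ^ c₁ ∣ M ∧
      ∀ i, 1 ≤ i → i ≤ k → dCubeSide (F.P K).L M (RkOfRecord (F.P K).L ν.r (g i)) i ∣ (F.P K).sitesPerDir 0) B₃ B₃' a₀ a₁ →
      ∃ γ₀ ε₀ ε₂₉ β' : ℝ, 0 < γ₀ ∧ 0 < ε₀ ∧ 0 < ε₂₉ ∧
        BetaLowerH (-β') γ₀ (betaOfRecord₁₃ F 2 (theta13OfThm1CCM F 2 j ε₀ ε₂₉ B₃ B₃' a₀ a₁)) ∧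
        BetaUpperH β' γ₀ (betaOfRecord₁₃ F 2 (theta13OfThm1CCM F 2 j ε₀ ε₂₉ B₃ B₃' a₀ a₁)))
    (h05 : ∀ (F : T4Family) {j : ℕ} {γ ε₀ ε₂₉ B₃ B₃' a₀ a₁ : ℝ} (hγ₀ : 0 < γ) (hγh : γ ≤ 1 / 2) (hε : 0 < ε₀) (hε' : 0 < ε₂₉) (hB : 0 ≤ B₃) (hB' : 0 ≤ B₃') (ha₀ : 0 < a₀) (ha₁ : 0 < a₁) {bl β' : ℝ} (hbox : BetaLowerH bl γ (betaOfRecord₁₃ F 2 (theta13OfThm1CCMWZ F 2 j γ ε₀ ε₂₉ B₃ B₃' a₀ a₁ (Efl F) (logz F)))) (hbox' : BetaUpperH β' γ (betaOfRecord₁₃ F 2 (theta13OfThm1CCMWZ F 2 j γ ε₀ ε₂₉ B₃ B₃' a₀ a₁ (Efl F) (logz F)))) (hl : -bl * γ ^ 2 ≤ 3) (hβ' : β' * γ ^ 2 ≤ 3 / 4),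
      ∃ lam8 : ResidB8 (theta13OfThm1CCMWZ F 2 j γ ε₀ ε₂₉ B₃ B₃' a₀ a₁ (Efl F) (logz F)).toStage3Params, B8LeafOfRecordSubBP (theta13OfThm1CCMWZ F 2 j γ ε₀ ε₂₉ B₃ B₃' a₀ a₁ (Efl F) (logz F)).toStage3Params lam8)
    (h06 : ∀ (F : T4Family) {j : ℕ} {γ ε₀ ε₂₉ B₃ B₃' a₀ a₁ : ℝ} (hγ₀ : 0 < γ) (hγh : γ ≤ 1 / 2) (hε : 0 < ε₀) (hε' : 0 < ε₂₉) (hB : 0 ≤ B₃) (hB' : 0 ≤ B₃') (ha₀ : 0 < a₀) (ha₁ : 0 < a₁) {bl β' : ℝ} (hbox : BetaLowerH bl γ (betaOfRecord₁₃ F 2 (theta13OfThm1CCMWZ F 2 j γ ε₀ ε₂₉ B₃ B₃' a₀ a₁ (Efl F) (logz F)))) (hbox' : BetaUpperH β' γ (betaOfRecord₁₃ F 2 (theta13OfThm1CCMWZ F 2 j γ ε₀ ε₂₉ B₃ B₃' a₀ a₁ (Efl F) (logz F)))) (hl : -bl * γ ^ 2 ≤ 3) (hβ' : β' * γ ^ 2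 ≤ 3 / 4),
      ∃ (Mstar : ℕ) (ops : OpsY 2 (theta13OfThm1CCMWZ F 2 j γ ε₀ ε₂₉ B₃ B₃' a₀ a₁ (Efl F) (logz F)).toStage3Params Mstar), B9LeafX (Y9OfRecord 2 (theta13OfThm1CCMWZ F 2 j γ ε₀ ε₂₉ B₃ B₃' a₀ a₁ (Efl F) (logz F)).toStage3Params Mstar ops))
    (h07 : ∀ F : T4Family, ∃ ζ : ResidZ F 2, B11Leaf (Z11OfRecord F 2 ζ))
    (h08 : ∀ F : T4Family, PrintedUV3V 2 F.L)
    (h09 : ∀ (F : T4Family) {j : ℕ} {γ ε₀ ε₂₉ B₃ B₃' a₀ a₁ : ℝ} (hγ₀ : 0 < γ) (hγh : γ ≤ 1 / 2) (hε : 0 < ε₀) (hε' : 0 < ε₂₉) (hB : 0 ≤ B₃) (hB' : 0 ≤ B₃') (ha₀ : 0 < a₀) (ha₁ : 0 < a₁) {bl β' : ℝ} (hbox : BetaLowerH bl γ (betaOfRecord₁₃ F 2 (theta13OfThm1CCMWZ F 2 j γ ε₀ ε₂₉ B₃ B₃' a₀ a₁ (Efl F) (logz F)))) (hbox' : BetaUpperH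 β' γ (betaOfRecord₁₃ F 2 (theta13OfThm1CCMWZ F 2 j γ ε₀ ε₂₉ B₃ B₃' a₀ a₁ (Efl F) (logz F)))) (hl : -bl * γ ^ 2 ≤ 3) (hβ' : β' * γ ^ 2 ≤ 3 / 4),
      ∃ lam12 : ResidB12 F 2 (theta13OfThm1CCMWZ F 2 j γ ε₀ ε₂₉ B₃ B₃' a₀ a₁ (Efl F) (logz F)).τ9.M,
      ∀ P : B12.RunParams, B12Sec2to5.Lemma4Printed (F12OfRecord₁₂ F 2 (theta13OfThm1CCMWZ F 2 j γ ε₀ ε₂₉ B₃ B₃' a₀ a₁ (Efl F) (logz F)).toStage12Params lam12 P) (lam12 P).consts)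
    (h09T : ∀ (F : T4Family) {j : ℕ} {γ ε₀ ε₂₉ B₃ B₃' a₀ a₁ : ℝ} (hγ₀ : 0 < γ) (hγh : γ ≤ 1 / 2) (hε : 0 < ε₀) (hε' : 0 < ε₂₉) (hB : 0 ≤ B₃) (hB' : 0 ≤ B₃') (ha₀ : 0 < a₀) (ha₁ : 0 < a₁) {bl β' : ℝ} (hbox : BetaLowerH bl γ (betaOfRecord₁₃ F 2 (theta13OfThm1CCMWZ F 2 j γ ε₀ ε₂₉ B₃ B₃' a₀ a₁ (Efl F) (logz F)))) (hbox' : BetaUpperH β' γ (betaOfRecord₁₃ F 2 (theta13OfThm1CCMWZ F 2 j γ ε₀ ε₂₉ B₃ B₃' a₀ a₁ (Efl F) (logz F)))) (hl : -bl * γ ^ 2 ≤ 3) (hβ' : β' * γ ^ 2 ≤ 3 / 4)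
      (hP : (gaussPinH (Stage13HParams.ofHistoryBlind F 2 (Stage13RParams.ofCured F 2 (theta13OfThm1CCMWZ F 2 j γ ε₀ ε₂₉ B₃ B₃' a₀ a₁ (Efl F) (logz F))))).Provisos₁₃SepCoPH F 2),
      ∃ γ₉ : ℝ, 0 < γ₉ ∧ ∀ w : WorldP, w.C = (datumOfRecord₁₃SepCoPH F 2 (gaussPinH (Stage13HParams.ofHistoryBlind F 2 (Stage13RParams.ofCured F 2 (theta13OfThm1CCMWZ F 2 j γ ε₀ ε₂₉ B₃ B₃' a₀ a₁ (Efl F) (logz F))))) hP).C →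
      w.γ ≤ γ₉ → ∀ P : B12.RunParams, (leavesP w P).smallCouplings → (leavesP w P).smallFieldInductive)
    (h10 : ∀ (F : T4Family) {j : ℕ} {γ ε₀ ε₂₉ B₃ B₃' a₀ a₁ : ℝ} (hγ₀ : 0 < γ) (hγh : γ ≤ 1 / 2) (hε : 0 < ε₀) (hε' : 0 < ε₂₉) (hB : 0 ≤ B₃) (hB' : 0 ≤ B₃') (ha₀ : 0 < a₀) (ha₁ : 0 < a₁) {bl β' : ℝ} (hbox : BetaLowerH bl γ (betaOfRecord₁₃ F 2 (theta13OfThm1CCMWZ F 2 j γ ε₀ ε₂₉ B₃ B₃' a₀ a₁ (Efl F) (logz F)))) (hbox' : BetaUpperH β' γ (betaOfRecord₁₃ F 2 (theta13OfThm1CCMWZ F 2 j γ ε₀ ε₂₉ B₃ B₃' a₀ a₁ (Efl F) (logz F)))) (hl : -bl * γ ^ 2 ≤ 3) (hβ' : β' * γ ^ 2 ≤ 3 / 4),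
      ∃ lam13 : B12.RunParams → ResidB13 (theta13OfThm1CCMWZ F 2 j γ ε₀ ε₂₉ B₃ B₃' a₀ a₁ (Efl F) (logz F)).toStage3Params,
      ∀ P : B12.RunParams, B13LeafOfRecord (theta13OfThm1CCMWZ F 2 j γ ε₀ ε₂₉ B₃ B₃' a₀ a₁ (Efl F) (logz F)).toStage3Params (lam13 P))
    (h11N : ∀ (F : T4Family) {j : ℕ} {γ ε₀ ε₂₉ B₃ B₃' a₀ a₁ : ℝ} (hγ₀ : 0 < γ) (hγh : γ ≤ 1 / 2) (hε : 0 < ε₀) (hε' : 0 < ε₂₉) (hB : 0 ≤ B₃) (hB' : 0 ≤ B₃') (ha₀ : 0 < a₀) (ha₁ : 0 < a₁) {bl β' : ℝ} (hbox : BetaLowerH bl γ (betaOfRecord₁₃ F 2 (theta13OfThm1CCMWZ F 2 j γ ε₀ ε₂₉ B₃ B₃' a₀ a₁ (Efl F) (logz F)))) (hbox' : BetaUpperH β' γ (betaOfRecord₁₃ F 2 (theta13OfThm1CCMWZ F 2 j γ ε₀ ε₂₉ B₃ B₃' a₀ a₁ (Efl F) (logz F)))) (hl : -bl * γ ^ 2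 ≤ 3) (hβ' : β' * γ ^ 2 ≤ 3 / 4),
      ∃ σ : (P : B12.RunParams) → Sect3Supplier (gaussPinH (Stage13HParams.ofHistoryBlind F 2 (Stage13RParams.ofCured F 2 (theta13OfThm1CCMWZ F 2 j γ ε₀ ε₂₉ B₃ B₃' a₀ a₁ (Efl F) (logz F))))) P,
        (∀ P : B12.RunParams, Step.InInterval γ P.K (gOfRecord₁₃ F 2 (theta13OfThm1CCMWZ F 2 j γ ε₀ ε₂₉ B₃ B₃' a₀ a₁ (Efl F) (logz F)) P) → SupplierObligations (gaussPinH (Stage13HParams.ofHistoryBlind F 2 (Stage13RParams.ofCured F 2 (theta13OfThm1CCMWZ F 2 j γ ε₀ ε₂₉ B₃ B₃' a₀ a₁ (Efl F) (logz F))))) P (σ P)) ∧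
        (∀ P : B12.RunParams, Step.InInterval γ P.K (gOfRecord₁₃ F 2 (theta13OfThm1CCMWZ F 2 j γ ε₀ ε₂₉ B₃ B₃' a₀ a₁ (Efl F) (logz F)) P) → OperandRowsAlongChain (gaussPinH (Stage13HParams.ofHistoryBlind F 2 (Stage13RParams.ofCured F 2 (theta13OfThm1CCMWZ F 2 j γ ε₀ ε₂₉ B₃ B₃' a₀ a₁ (Efl F) (logz F))))) P (σ P)))
    (h12 : ∀ (F : T4Family) {j : ℕ} {γ ε₀ ε₂₉ B₃ B₃' a₀ a₁ : ℝ} (hγ₀ : 0 < γ) (hγh : γ ≤ 1 / 2) (hε : 0 < ε₀) (hε' : 0 < ε₂₉) (hB : 0 ≤ B₃) (hB' : 0 ≤ B₃') (ha₀ : 0 < a₀) (ha₁ : 0 < a₁) {bl β' : ℝ} (hbox : BetaLowerH bl γ (betaOfRecord₁₃ F 2 (theta13OfThm1CCMWZ F 2 j γ ε₀ ε₂₉ B₃ B₃' a₀ a₁ (Efl F) (logz F)))) (hbox' : BetaUpperH β' γ (betaOfRecord₁₃ F 2 (theta13OfThm1CCMWZ F 2 j γ ε₀ ε₂₉ B₃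 B₃' a₀ a₁ (Efl F) (logz F)))) (hl : -bl * γ ^ 2 ≤ 3) (hβ' : β' * γ ^ 2 ≤ 3 / 4),
      ∃ lamW : ResidW F 2, (∀ P : B12.RunParams, B15Leaf (WOfRecord₁₃ F 2 (theta13OfThm1CCMWZ F 2 j γ ε₀ ε₂₉ B₃ B₃' a₀ a₁ (Efl F) (logz F)) lamW P)) ∧
      ∀ P : B12.RunParams, 1 ≤ P.K → lamW.kSel P < P.K)
    (h13 : ∀ (F : T4Family) {j : ℕ} {γ ε₀ ε₂₉ B₃ B₃' a₀ a₁ : ℝ} (hγ₀ : 0 < γ) (hγh : γ ≤ 1 / 2) (hε : 0 < ε₀) (hε' : 0 < ε₂₉) (hB : 0 ≤ B₃) (hB' : 0 ≤ B₃') (ha₀ : 0 < a₀) (ha₁ : 0 < a₁) {bl β' : ℝ} (hbox : BetaLowerH bl γ (betaOfRecord₁₃ F 2 (theta13OfThm1CCMWZ F 2 j γ ε₀ ε₂₉ B₃ B₃' a₀ a₁ (Efl F) (logz F)))) (hbox' : BetaUpperH β' γ (betaOfRecord₁₃ F 2 (theta13OfThm1CCMWZ F 2 j γ ε₀ ε₂₉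 B₃ B₃' a₀ a₁ (Efl F) (logz F)))) (hl : -bl * γ ^ 2 ≤ 3) (hβ' : β' * γ ^ 2 ≤ 3 / 4)
      (hP : (gaussPinH (Stage13HParams.ofHistoryBlind F 2 (Stage13RParams.ofCured F 2 (theta13OfThm1CCMWZ F 2 j γ ε₀ ε₂₉ B₃ B₃' a₀ a₁ (Efl F) (logz F))))).Provisos₁₃SepCoPH F 2),
      ∃ γ₁₃ : ℝ, 0 < γ₁₃ ∧ ∃ em ep : ℝ → ℝ, ∃ v : Revision₁₃ F 2 (gaussPinH (Stage13HParams.ofHistoryBlind F 2 (Stage13RParams.ofCured F 2 (theta13OfThm1CCMWZ F 2 j γ ε₀ ε₂₉ B₃ B₃' a₀ a₁ (Efl F) (logz F))))) hP,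
      ∀ P : B12.RunParams, (genFlow (betaOfRecord₁₃ F 2 (theta13OfThm1CCMWZ F 2 j γ ε₀ ε₂₉ B₃ B₃' a₀ a₁ (Efl F) (logz F))) P.g0).InInterval γ₁₃ P.K → ∀ k, k ≤ P.K → SLaw₁₃CoPH F 2 (gaussPinH (Stage13HParams.ofHistoryBlind F 2 (Stage13RParams.ofCured F 2 (theta13OfThm1CCMWZ F 2 j γ ε₀ ε₂₉ B₃ B₃' a₀ a₁ (Efl F) (logz F))))) P k →
      ∀ U : GaugeField (F.P P.K) k (SU 2),
        chiβOfRecord₁₃ F 2 (theta13OfThm1CCMWZ F 2 j γ ε₀ ε₂₉ B₃ B₃' a₀ a₁ (Efl F) (logz F)) P.K (gOfRecord₁₃ F 2 (theta13OfThm1CCMWZ F 2 j γ ε₀ ε₂₉ B₃ B₃' a₀ a₁ (Efl F) (logz F)) P) k U *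
              Real.exp (-(1 / (gOfRecord₁₃ F 2 (theta13OfThm1CCMWZ F 2 j γ ε₀ ε₂₉ B₃ B₃' a₀ a₁ (Efl F) (logz F)) P k) ^ 2 * wilsonBGOfRecord F 2 (theta13OfThm1CCMWZ F 2 j γ ε₀ ε₂₉ B₃ B₃' a₀ a₁ (Efl F) (logz F)).εbg P k U)
                - em (gOfRecord₁₃ F 2 (theta13OfThm1CCMWZ F 2 j γ ε₀ ε₂₉ B₃ B₃' a₀ a₁ (Efl F) (logz F)) P k) * (Fintype.card (Site (F.P P.K) k) : ℝ)) ≤ v.ρ P k U ∧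
        v.ρ P k U ≤ Real.exp (ep (gOfRecord₁₃ F 2 (theta13OfThm1CCMWZ F 2 j γ ε₀ ε₂₉ B₃ B₃' a₀ a₁ (Efl F) (logz F)) P k) * (Fintype.card (Site (F.P P.K) k) : ℝ)))
    (h₂ : ∀ F : T4Family, NodesAtSomeRecord13PWSVW F → RunRowsAtSomeRecord13PWSVW F)
    (h₃ : ∀ F : T4Family, RunRowsAtSomeRecord13PWSVW F → RunRowsContAtSomeRecord13PWSVW F) :
    Summit.QuantumFields.YangMills.Theses.BalabanUVNodes.StabilityBRunRowsAtRecordR13SepCoPHV :=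
  stabilityBRunRowsAtRecordR13SepCoPHV_of_stubTextsVW
    (N24_stub_nodes13PWSVW_text_gaussPinZ_doorGridG_of_openStubsGridG_of_children_n11OperandRows_boxLetters Efl logz h1G3 h3A'G3 h05 h06 h07 h08 h09 h09T h10 h11N h12 h13) h₂ h₃

end Summit.QuantumFields.YangMills.BalabanUVNodes.N24LineTwoRung1AtGaussPinZCertificateDoorGridGOfChildrenBoxLetters

end
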